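import Summits.KontsevichZagierPeriods.KontsevichZagierPeriods.Theorems.OctahedralSymmetryOctahedralSpanAllWeightsStubRegularE0DepthThreeBinaryCore
import HarnessLib

/-!
# Block F1 of the crux `OctahedralSpanAllWeights` (stmt-KontsevichZagierPeriods-9659), line `Sketch`: depth three over the poles `{0, i, -i}`

File 2/2: the registered sub-layer stub `stub_regular_e0_depthThree_binary` of block F1 — a
`4`-initial convergent `e₁`-free word of length `n` with exactly three unit letters, all in `{1, 3}`
(`4^{a₁} c₁ 4^{a₂} c₂ 4^{a₃} c₃`, `a₁ ≥ 1`, `m = a₁ + a₂ + a₃` letters `4`), reduces modulo `rel` to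
convergent `e₁`-free words of length `n` with fewer letters `4`. With the generators of file 1/2
(`…DepthThreeBinaryCore`: `relM33`, `relB`, `relB2`, here turned into the equations `y3_familyM33`,
`y3_familyB`, `y3_familyB2` between the classes `y3 m a₁ a₂ b₁ b₂ b₃`):
1. `depthThree_core` (`m ≥ 3`, any abelian group): M33, B, B2 kill all unknowns — a local
   elimination along the boundary of the simplex `a₁ + a₂ + a₃ = m`, uniform in `m`.
2. `m = 2` (length five): two lift families (`y3_liftK`: `c ш [4 c₁ 4 c₂]`; `y3_liftL`:
   `(4 c) ш [4 c₁ c₂]`, the depth-two words reducing by block F1 below length five) and the finite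
   elimination `depthThree_core_two` (rank `48`; in Lean: `linarith` on the values of linear
   functionals, `depthThree_core_two_rat`, and the colour swap).
3. `m = 1` (length four): `depthThree_one` of file 1/2 (the landed weight-four normal form).
4. The shape lemma `exists_X3` and the registered statement (namespace `…OctaSpan`).
The line's lab (`work/stubs/lab_F1b/`) found the families: M33 + B + B2 alone have full rank
`8·C(m+2, 2)` on the binary block for `3 ≤ m ≤ 9`; at `m = 2` lifts by a word containing `4` are
necessary (all internal families + letter lifts have corank `1`).

References: J. Zhao, Doc. Math. 15 (2010), §2 (FDS) [Zhao2010]; M. E. Hoffman, J. Algebra 194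
(1997), §2 [Hoffman1997].
-/

noncomputable section

namespace Summit.KontsevichZagierPeriods.OctahedralSymmetry.OctaSpan.RegularE0

open Literature.NumberTheory.Transcendental Literature.NumberTheory.Transcendental.LevelFour

/-! ## The three families as equations between the unknowns `y3` -/

/-- A three-term membership in `T3 m` as an equation between unknowns. [folklore] -/
theorem y3_eq_zero₃ {m : ℕ} {U V W : List (Fin 5)} {u v w : WordQ ⧸ T3 m}
    (hu : u = (T3 m).mkQ (sym U)) (hv : v = (T3 m).mkQ (sym V)) (hw : w = (T3 m).mkQ (sym W))
    (h : sym U + (sym V + sym W) ∈ T3 m) : u + (v + w) = 0 := by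
  rw [hu, hv, hw, ← map_add, ← map_add]
  exact (Submodule.Quotient.mk_eq_zero _).2 h

/-- **Family B for the unknowns** (`s ≥ 1`, `a₁ + a₂ + s ≤ m`). [folklore] -/
theorem y3_familyB (m s : ℕ) (hs : 1 ≤ s) (a₁ a₂ : ℕ) (h : a₁ + a₂ + s ≤ m) (b₁ b₂ b₃ : Bool) :
    y3 m a₁ a₂ b₁ b₂ (!b₃) + (y3 m a₁ (a₂ + s) b₁ (!b₂) (!b₃) +
      y3 m (a₁ + s) a₂ (!b₁) (!b₂) (!b₃)) = 0 := by
  have hr := relB a₁ a₂ (m - a₁ - a₂ - s) s hs b₁ b₂ b₃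
  rw [show a₁ + a₂ + (m - a₁ - a₂ - s) + s = m by omega] at hr
  exact y3_eq_zero₃ (y3_eq (by omega) _ _ _) (y3_eq (by omega) _ _ _) (y3_eq (by omega) _ _ _) hr

/-- **Family B2 for the unknowns** (`s, t ≥ 1`, `a₁ + a₂ + s + t ≤ m`). [folklore] -/
theorem y3_familyB2 (m s t : ℕ) (hs : 1 ≤ s) (ht : 1 ≤ t) (a₁ a₂ : ℕ) (h : a₁ + a₂ + s + t ≤ m)
    (b₁ b₂ b₃ : Bool) :
    y3 m a₁ (a₂ + s) b₁ (!b₂) (!b₃) + (y3 m (a₁ + s) a₂ (!b₁) (!b₂) (!b₃) +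
      y3 m (a₁ + s) (a₂ + t) (!b₁) (!b₂) (!b₃)) = 0 := by
  have hr := relB2 a₁ a₂ (m - a₁ - a₂ - s - t) s t hs ht b₁ b₂ b₃
  rw [show a₁ + a₂ + (m - a₁ - a₂ - s - t) + s + t = m by omega] at hr
  exact y3_eq_zero₃ (y3_eq (by omega) _ _ _) (y3_eq (by omega) _ _ _) (y3_eq (by omega) _ _ _) hr

/-- **Family M33 for the unknowns**: the interior of the simplex vanishes. [folklore] -/
theorem y3_familyM33 (m a₁ a₂ : ℕ) (h : a₁ + a₂ + 3 ≤ m) (b₁ b₂ b₃ : Bool) :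
    y3 m (a₁ + 1) (a₂ + 1) b₁ b₂ b₃ = 0 := by
  have hr := relM33 a₁ a₂ (m - a₁ - a₂ - 3) (!b₁) (!b₂) (!b₃)
  rw [show a₁ + a₂ + (m - a₁ - a₂ - 3) + 3 = m by omega, Bool.not_not, Bool.not_not,
    Bool.not_not] at hr
  rw [y3_eq (by omega : a₁ + 1 + (a₂ + 1) + (m - a₁ - a₂ - 3 + 1) = m)]
  exact (Submodule.Quotient.mk_eq_zero _).2 hr

/-! ## The algebraic core of the binary block, `m ≥ 3` -/

/-- **Algebraic core of the binary depth-three block, all `m ≥ 3`.** In an abelian group, unknowns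
`y a₁ a₂ b₁ b₂ b₃` (`a₁ + a₂ ≤ m`, standing for `[4^{a₁} c₁ 4^{a₂} c₂ 4^{m-a₁-a₂} c₃]`, colour bits
`bⱼ`, `!` = swap `i ↔ -i`) subject to family M33 (the interior `a₁, a₂, m-a₁-a₂ ≥ 1` vanishes),
family B (`s ≥ 1`) and family B2 (`s = 1`, `t ≥ 1`) all vanish: the families are local on the
boundary of the simplex — B2 with M33 kills the three edges away from the vertices (first
`y 1 (m-1)`, then the edge `a₁ = 0`, then `a₂ = 0` and `a₃ = 0` against each other), B the points
next to the vertices and the vertices. Uniform in `m`; no division. [folklore] -/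
theorem depthThree_core {Q : Type*} [AddCommGroup Q] (m : ℕ) (hm : 3 ≤ m)
    (y : ℕ → ℕ → Bool → Bool → Bool → Q)
    (M33 : ∀ a₁ a₂, a₁ + a₂ + 3 ≤ m → ∀ b₁ b₂ b₃, y (a₁ + 1) (a₂ + 1) b₁ b₂ b₃ = 0)
    (B : ∀ s, 1 ≤ s → ∀ a₁ a₂, a₁ + a₂ + s ≤ m → ∀ b₁ b₂ b₃ : Bool,
      y a₁ a₂ b₁ b₂ (!b₃) + (y a₁ (a₂ + s) b₁ (!b₂) (!b₃) + y (a₁ + s) a₂ (!b₁) (!b₂) (!b₃)) = 0)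
    (B2 : ∀ t, 1 ≤ t → ∀ a₁ a₂, a₁ + a₂ + 1 + t ≤ m → ∀ b₁ b₂ b₃ : Bool,
      y a₁ (a₂ + 1) b₁ (!b₂) (!b₃) + (y (a₁ + 1) a₂ (!b₁) (!b₂) (!b₃) +
        y (a₁ + 1) (a₂ + t) (!b₁) (!b₂) (!b₃)) = 0) :
    ∀ a₁ a₂, a₁ + a₂ ≤ m → ∀ b₁ b₂ b₃, y a₁ a₂ b₁ b₂ b₃ = 0 := by
  have U3 : ∀ {a₁ a₂}, (∀ b₁ b₂ b₃, y a₁ a₂ (!b₁) (!b₂) (!b₃) = 0) → ∀ b₁ b₂ b₃,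
      y a₁ a₂ b₁ b₂ b₃ = 0 := fun h b₁ b₂ b₃ => by simpa using h (!b₁) (!b₂) (!b₃)
  have U2 : ∀ {a₁ a₂}, (∀ b₁ b₂ b₃, y a₁ a₂ b₁ (!b₂) (!b₃) = 0) → ∀ b₁ b₂ b₃,
      y a₁ a₂ b₁ b₂ b₃ = 0 := fun h b₁ b₂ b₃ => by simpa using h b₁ (!b₂) (!b₃)
  have U1 : ∀ {a₁ a₂}, (∀ b₁ b₂ b₃, y a₁ a₂ b₁ b₂ (!b₃) = 0) → ∀ b₁ b₂ b₃,
      y a₁ a₂ b₁ b₂ b₃ = 0 := fun h b₁ b₂ b₃ => by simpa using h b₁ b₂ (!b₃)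
  have h11 : ∀ b₁ b₂ b₃, y 1 1 b₁ b₂ b₃ = 0 := M33 0 0 (by omega)
  have E1 : ∀ b₁ b₂ b₃ : Bool, y 0 1 b₁ (!b₂) (!b₃) + y 1 0 (!b₁) (!b₂) (!b₃) = 0 := by
    intro b₁ b₂ b₃
    have e := B2 1 le_rfl 0 0 (by omega) b₁ b₂ b₃
    simp only [zero_add, h11, add_zero] at e
    exact e
  have f31 : ∀ b₁ b₂ b₃, y 1 (m - 1) b₁ b₂ b₃ = 0 := U3 fun b₁ b₂ b₃ => by
    have e := B2 (m - 1) (by omega) 0 0 (by omega) b₁ b₂ b₃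
    simp only [zero_add] at e
    rwa [← add_assoc, E1, zero_add] at e
  have f1 : ∀ c, c + 3 ≤ m → ∀ b₁ b₂ b₃, y 0 (c + 2) b₁ b₂ b₃ = 0 := fun c hc => U2 fun b₁ b₂ b₃ => by
    have e := B2 (m - 2 - c) (by omega) 0 (c + 1) (by omega) b₁ b₂ b₃
    have i : y 1 (c + 1) (!b₁) (!b₂) (!b₃) = 0 := M33 0 c (by omega) _ _ _
    simp only [zero_add] at e
    rwa [i, show c + 1 + (m - 2 - c) = m - 1 by omega, f31, add_zero, add_zero] at e
  have f11 : ∀ b₁ b₂ b₃, y 0 1 b₁ b₂ b₃ = 0 := U1 fun b₁ b₂ b₃ => by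
    have e := B 1 le_rfl 0 1 (by omega) b₁ b₂ b₃
    rwa [zero_add, f1 0 hm, h11, add_zero, add_zero] at e
  have fe1 : ∀ t, 1 ≤ t → t + 1 ≤ m → ∀ b₁ b₂ b₃, y 0 t b₁ b₂ b₃ = 0 := by
    intro t ht htm b₁ b₂ b₃
    rcases Nat.lt_or_ge t 2 with h | h
    · rw [show t = 1 by omega]; exact f11 b₁ b₂ b₃
    · have := f1 (t - 2) (by omega) b₁ b₂ b₃; rwa [show t - 2 + 2 = t by omega] at this
  have f21 : ∀ b₁ b₂ b₃, y 1 0 b₁ b₂ b₃ = 0 := U3 fun b₁ b₂ b₃ => by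
    have e := E1 b₁ b₂ b₃; rwa [f11, zero_add] at e
  have f2 : ∀ c, c + 4 ≤ m → ∀ b₁ b₂ b₃, y (c + 2) 0 b₁ b₂ b₃ = 0 := fun c hc => U3 fun b₁ b₂ b₃ => by
    have e := B2 1 le_rfl (c + 1) 0 (by omega) b₁ b₂ b₃
    rwa [M33 c 0 (by omega), M33 (c + 1) 0 (by omega), zero_add, add_zero] at e
  have f3 : ∀ c, c + 3 ≤ m → ∀ b₁ b₂ b₃,
      y (c + 2) 0 b₁ b₂ b₃ + y (c + 2) (m - c - 2) b₁ b₂ b₃ = 0 := fun c hc b₁ b₂ b₃ => by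
    have e := B2 (m - c - 2) (by omega) (c + 1) 0 (by omega) (!b₁) (!b₂) (!b₃)
    simp only [Bool.not_not, zero_add] at e
    rwa [M33 c 0 hc, zero_add] at e
  have f2m : ∀ b₁ b₂ b₃, y (m - 1) 0 b₁ b₂ b₃ = 0 := U3 fun b₁ b₂ b₃ => by
    have e := B (m - 2) (by omega) 1 0 (by omega) b₁ b₂ b₃
    have i := M33 0 (m - 3) (by omega) b₁ (!b₂) (!b₃)
    rw [zero_add, show m - 3 + 1 = 0 + (m - 2) by omega] at i
    rwa [f21, i, zero_add, zero_add, show 1 + (m - 2) = m - 1 by omega] at e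
  have f3m : ∀ b₁ b₂ b₃, y (m - 1) 1 b₁ b₂ b₃ = 0 := fun b₁ b₂ b₃ => by
    have e := f3 (m - 3) (by omega) b₁ b₂ b₃
    rwa [show m - 3 + 2 = m - 1 by omega, show m - (m - 3) - 2 = 1 by omega, f2m, zero_add] at e
  have P : ∀ b₁ b₂ b₃, y 0 0 b₁ b₂ b₃ = 0 := U1 fun b₁ b₂ b₃ => by
    have e := B 1 le_rfl 0 0 (by omega) b₁ b₂ b₃
    rwa [zero_add, f11, f21, add_zero, add_zero] at e
  have Qv : ∀ b₁ b₂ b₃, y 0 m b₁ b₂ b₃ = 0 := U2 fun b₁ b₂ b₃ => by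
    have e := B 1 le_rfl 0 (m - 1) (by omega) b₁ b₂ b₃
    rwa [zero_add, fe1 (m - 1) (by omega) (by omega), f31, add_zero, zero_add,
      show m - 1 + 1 = m by omega] at e
  have R : ∀ b₁ b₂ b₃, y m 0 b₁ b₂ b₃ = 0 := U3 fun b₁ b₂ b₃ => by
    have e := B 1 le_rfl (m - 1) 0 (by omega) b₁ b₂ b₃
    rwa [zero_add, f2m, f3m, zero_add, zero_add, show m - 1 + 1 = m by omega] at e
  intro a₁ a₂ h b₁ b₂ b₃
  rcases a₁ with _ | a₁
  · rcases Nat.eq_zero_or_pos a₂ with rfl | h2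
    · exact P b₁ b₂ b₃
    rcases eq_or_lt_of_le h with h3 | h3
    · rw [zero_add] at h3; rw [h3]; exact Qv b₁ b₂ b₃
    · exact fe1 a₂ h2 (by omega) b₁ b₂ b₃
  rcases a₂ with _ | a₂
  · -- the edge a₂ = 0
    rcases Nat.lt_or_ge (a₁ + 1) 2 with h1 | h1
    · rw [show a₁ + 1 = 1 by omega]; exact f21 b₁ b₂ b₃
    rcases Nat.lt_or_ge (a₁ + 1) (m - 1) with h2 | h2
    · have := f2 (a₁ - 1) (by omega) b₁ b₂ b₃; rwa [show a₁ - 1 + 2 = a₁ + 1 by omega] at this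
    rcases eq_or_lt_of_le h2 with h3 | h3
    · rw [← h3]; exact f2m b₁ b₂ b₃
    · rw [show a₁ + 1 = m by omega]; exact R b₁ b₂ b₃
  rcases Nat.lt_or_ge (a₁ + 1 + (a₂ + 1)) m with h1 | h1
  · exact M33 a₁ a₂ (by omega) b₁ b₂ b₃
  -- the edge a₃ = 0: a₂ + 1 = m - (a₁ + 1)
  rcases Nat.lt_or_ge (a₁ + 1) 2 with h2 | h2
  · rw [show a₁ + 1 = 1 by omega, show a₂ + 1 = m - 1 by omega]; exact f31 b₁ b₂ b₃
  rcases Nat.lt_or_ge (a₁ + 1) (m - 1) with h3 | h3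
  · have e := f3 (a₁ - 1) (by omega) b₁ b₂ b₃
    rwa [f2 (a₁ - 1) (by omega), zero_add, show a₁ - 1 + 2 = a₁ + 1 by omega,
      show m - (a₁ - 1) - 2 = a₂ + 1 by omega] at e
  · rw [show a₁ + 1 = m - 1 by omega, show a₂ + 1 = 1 by omega]; exact f3m b₁ b₂ b₃

/-! ## The layer `m = 2` (length five): two lift families and a finite elimination -/

/-- **Lift family K at `m = 2`**: `c ш [4 c₁ 4 c₂] ≡ 0` (the depth-two word reduces, F1 below
length five). [folklore] -/
theorem y3_liftK (hlow : ∀ W : List (Fin 5), W.length < 5 → IsConvergent W →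
      W.count 0 = 0 → 0 < W.count 4 → sym W ∈ rel ⊔ e0Lower W) (c c₁ c₂ : Bool) :
    y3 2 0 1 c c₁ c₂ + (y3 2 1 0 c c₁ c₂ + (y3 2 1 0 c₁ c c₂ + (y3 2 1 1 c₁ c c₂ +
      y3 2 1 1 c₁ c₂ c))) = 0 := by
  have hV := hlow [4, col c₁, 4, col c₂] (by simp) ⟨by simp, by simp [col_ne_four]⟩
    (by simp [col_ne_zero]) (by simp)
  have h := liftMap_mem_sup_e0Lower' (u := [col c]) ⟨by simp [col_ne_zero], by simp [col_ne_four]⟩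
    (by simp [col_ne_zero]) hV
  have hL : e0Lower ([col c] ++ [4, col c₁, 4, col c₂]) = e0Lower (X3 0 0 2 true true true) :=
    e0Lower_eq (by simp [X3]) (by simp [X3, col_ne_four])
  rw [liftMap_sym_eq_sum, hL] at h
  have h0 := (Submodule.Quotient.mk_eq_zero (T3 2)).2 h
  simpa [y3, X3, List.replicate] using h0

/-- **Lift family L at `m = 2`**: `(4 c) ш [4 c₁ c₂] ≡ 0` (the lifting word contains the pole `0`).
[folklore] -/
theorem y3_liftL (hlow : ∀ W : List (Fin 5), W.length < 5 → IsConvergent W →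
      W.count 0 = 0 → 0 < W.count 4 → sym W ∈ rel ⊔ e0Lower W) (c c₁ c₂ : Bool) :
    y3 2 1 1 c c₁ c₂ + (y3 2 2 0 c c₁ c₂ + (y3 2 2 0 c₁ c c₂ + (y3 2 2 0 c₁ c₂ c +
      (y3 2 2 0 c c₁ c₂ + (y3 2 2 0 c₁ c c₂ + (y3 2 2 0 c₁ c₂ c + (y3 2 1 1 c₁ c c₂ +
        (y3 2 1 1 c₁ c₂ c + y3 2 1 0 c₁ c₂ c)))))))) = 0 := by
  have hV := hlow [4, col c₁, col c₂] (by simp) ⟨by simp, by simp [col_ne_four]⟩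
    (by simp [col_ne_zero]) (by simp)
  have h := liftMap_mem_sup_e0Lower' (u := [4, col c]) ⟨by simp, by simp [col_ne_four]⟩
    (by simp [col_ne_zero]) hV
  have hL : e0Lower ([4, col c] ++ [4, col c₁, col c₂]) = e0Lower (X3 0 0 2 true true true) :=
    e0Lower_eq (by simp [X3]) (by simp [X3, col_ne_four])
  rw [liftMap_sym_eq_sum, hL] at h
  have h0 := (Submodule.Quotient.mk_eq_zero (T3 2)).2 h
  simpa [y3, X3, List.replicate] using h0

/-- **Algebraic core of the binary block at `m = 2`, rational form.** Unknowns `z a₁ a₂ b₁ b₂ b₃ ∈ ℚ`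
subject to families B (`s = 1`; `s = 2` at the origin), B2 (`s = t = 1` at the origin), K and L:
those with `a₁ ≥ 1` and first colour bit `true` vanish — linear arithmetic on the `56` equations
(the lab's exact elimination: all `48` unknowns vanish, rank `48`). [folklore] -/
theorem depthThree_core_two_rat (z : ℕ → ℕ → Bool → Bool → Bool → ℚ)
    (B1 : ∀ a₁ a₂, a₁ + a₂ + 1 ≤ 2 → ∀ b₁ b₂ b₃ : Bool,
      z a₁ a₂ b₁ b₂ (!b₃) + (z a₁ (a₂ + 1) b₁ (!b₂) (!b₃) + z (a₁ + 1) a₂ (!b₁) (!b₂) (!b₃)) = 0)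
    (Bt : ∀ b₁ b₂ b₃ : Bool, z 0 0 b₁ b₂ (!b₃) + (z 0 2 b₁ (!b₂) (!b₃) + z 2 0 (!b₁) (!b₂) (!b₃)) = 0)
    (Bh : ∀ b₁ b₂ b₃ : Bool, z 0 1 b₁ (!b₂) (!b₃) + (z 1 0 (!b₁) (!b₂) (!b₃) + z 1 1 (!b₁) (!b₂) (!b₃)) = 0)
    (K : ∀ c c₁ c₂ : Bool, z 0 1 c c₁ c₂ + (z 1 0 c c₁ c₂ + (z 1 0 c₁ c c₂ + (z 1 1 c₁ c c₂ +
      z 1 1 c₁ c₂ c))) = 0)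
    (L : ∀ c c₁ c₂ : Bool, z 1 1 c c₁ c₂ + (z 2 0 c c₁ c₂ + (z 2 0 c₁ c c₂ + (z 2 0 c₁ c₂ c +
      (z 2 0 c c₁ c₂ + (z 2 0 c₁ c c₂ + (z 2 0 c₁ c₂ c + (z 1 1 c₁ c c₂ +
        (z 1 1 c₁ c₂ c + z 1 0 c₁ c₂ c)))))))) = 0) (b₂ b₃ : Bool) :
    z 1 0 true b₂ b₃ = 0 ∧ z 1 1 true b₂ b₃ = 0 ∧ z 2 0 true b₂ b₃ = 0 := by
  have hB00 := B1 0 0 (by norm_num)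
  have hB01 := B1 0 1 (by norm_num)
  have hB10 := B1 1 0 (by norm_num)
  simp only [zero_add, Bool.forall_bool, Bool.not_false, Bool.not_true] at hB00
  simp only [zero_add, Nat.reduceAdd, Bool.forall_bool, Bool.not_false, Bool.not_true] at hB01
  simp only [zero_add, Nat.reduceAdd, Bool.forall_bool, Bool.not_false, Bool.not_true] at hB10
  simp only [Bool.forall_bool, Bool.not_false, Bool.not_true] at Bt Bh K L
  obtain ⟨⟨⟨e1, e2⟩, e3, e4⟩, ⟨e5, e6⟩, e7, e8⟩ := hB00
  obtain ⟨⟨⟨f1, f2⟩, f3, f4⟩, ⟨f5, f6⟩, f7, f8⟩ := hB01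
  obtain ⟨⟨⟨g1, g2⟩, g3, g4⟩, ⟨g5, g6⟩, g7, g8⟩ := hB10
  obtain ⟨⟨⟨i1, i2⟩, i3, i4⟩, ⟨i5, i6⟩, i7, i8⟩ := Bt
  obtain ⟨⟨⟨j1, j2⟩, j3, j4⟩, ⟨j5, j6⟩, j7, j8⟩ := Bh
  obtain ⟨⟨⟨k1, k2⟩, k3, k4⟩, ⟨k5, k6⟩, k7, k8⟩ := K
  obtain ⟨⟨⟨l1, l2⟩, l3, l4⟩, ⟨l5, l6⟩, l7, l8⟩ := L
  cases b₂ <;> cases b₃ <;> refine ⟨?_, ?_, ?_⟩ <;> linarith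

/-- **Algebraic core of the binary block at `m = 2`** (length five): in a `ℚ`-vector space the
unknowns with `a₁ ≥ 1` vanish under families B, B2, K, L — the rational form applied to the values
`φ ∘ y` of all linear functionals `φ`, for `y` and for its colour swap. [folklore] -/
theorem depthThree_core_two {Q : Type*} [AddCommGroup Q] [Module ℚ Q]
    (y : ℕ → ℕ → Bool → Bool → Bool → Q)
    (B1 : ∀ a₁ a₂, a₁ + a₂ + 1 ≤ 2 → ∀ b₁ b₂ b₃ : Bool,
      y a₁ a₂ b₁ b₂ (!b₃) + (y a₁ (a₂ + 1) b₁ (!b₂) (!b₃) + y (a₁ + 1) a₂ (!b₁) (!b₂) (!b₃)) = 0)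
    (Bt : ∀ b₁ b₂ b₃ : Bool, y 0 0 b₁ b₂ (!b₃) + (y 0 2 b₁ (!b₂) (!b₃) + y 2 0 (!b₁) (!b₂) (!b₃)) = 0)
    (Bh : ∀ b₁ b₂ b₃ : Bool, y 0 1 b₁ (!b₂) (!b₃) + (y 1 0 (!b₁) (!b₂) (!b₃) + y 1 1 (!b₁) (!b₂) (!b₃)) = 0)
    (K : ∀ c c₁ c₂ : Bool, y 0 1 c c₁ c₂ + (y 1 0 c c₁ c₂ + (y 1 0 c₁ c c₂ + (y 1 1 c₁ c c₂ +
      y 1 1 c₁ c₂ c))) = 0)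
    (L : ∀ c c₁ c₂ : Bool, y 1 1 c c₁ c₂ + (y 2 0 c c₁ c₂ + (y 2 0 c₁ c c₂ + (y 2 0 c₁ c₂ c +
      (y 2 0 c c₁ c₂ + (y 2 0 c₁ c c₂ + (y 2 0 c₁ c₂ c + (y 1 1 c₁ c c₂ +
        (y 1 1 c₁ c₂ c + y 1 0 c₁ c₂ c)))))))) = 0) (b₁ b₂ b₃ : Bool) :
    y 1 0 b₁ b₂ b₃ = 0 ∧ y 1 1 b₁ b₂ b₃ = 0 ∧ y 2 0 b₁ b₂ b₃ = 0 := by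
  -- the values of linear functionals, first colour bit `true`, for any such `w`
  have key : ∀ w : ℕ → ℕ → Bool → Bool → Bool → Q,
      (∀ a₁ a₂, a₁ + a₂ + 1 ≤ 2 → ∀ b₁ b₂ b₃ : Bool, w a₁ a₂ b₁ b₂ (!b₃) +
        (w a₁ (a₂ + 1) b₁ (!b₂) (!b₃) + w (a₁ + 1) a₂ (!b₁) (!b₂) (!b₃)) = 0) →
      (∀ b₁ b₂ b₃ : Bool, w 0 0 b₁ b₂ (!b₃) + (w 0 2 b₁ (!b₂) (!b₃) + w 2 0 (!b₁) (!b₂) (!b₃)) = 0) →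
      (∀ b₁ b₂ b₃ : Bool, w 0 1 b₁ (!b₂) (!b₃) + (w 1 0 (!b₁) (!b₂) (!b₃) +
        w 1 1 (!b₁) (!b₂) (!b₃)) = 0) →
      (∀ c c₁ c₂ : Bool, w 0 1 c c₁ c₂ + (w 1 0 c c₁ c₂ + (w 1 0 c₁ c c₂ + (w 1 1 c₁ c c₂ +
        w 1 1 c₁ c₂ c))) = 0) →
      (∀ c c₁ c₂ : Bool, w 1 1 c c₁ c₂ + (w 2 0 c c₁ c₂ + (w 2 0 c₁ c c₂ + (w 2 0 c₁ c₂ c +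
        (w 2 0 c c₁ c₂ + (w 2 0 c₁ c c₂ + (w 2 0 c₁ c₂ c + (w 1 1 c₁ c c₂ +
          (w 1 1 c₁ c₂ c + w 1 0 c₁ c₂ c)))))))) = 0) →
      ∀ b₂ b₃, w 1 0 true b₂ b₃ = 0 ∧ w 1 1 true b₂ b₃ = 0 ∧ w 2 0 true b₂ b₃ = 0 := by
    intro w h1 h2 h3 h4 h5 b₂ b₃
    simp only [← Module.forall_dual_apply_eq_zero_iff ℚ (w _ _ _ _ _), ← forall_and]
    intro φ
    refine depthThree_core_two_rat (fun a₁ a₂ b₁ b₂ b₃ => φ (w a₁ a₂ b₁ b₂ b₃))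
      (fun a₁ a₂ h c₁ c₂ c₃ => ?_) (fun c₁ c₂ c₃ => ?_) (fun c₁ c₂ c₃ => ?_) (fun c₁ c₂ c₃ => ?_)
      (fun c₁ c₂ c₃ => ?_) b₂ b₃
    · simpa using congrArg φ (h1 a₁ a₂ h c₁ c₂ c₃)
    · simpa using congrArg φ (h2 c₁ c₂ c₃)
    · simpa using congrArg φ (h3 c₁ c₂ c₃)
    · simpa using congrArg φ (h4 c₁ c₂ c₃)
    · simpa using congrArg φ (h5 c₁ c₂ c₃)
  cases b₁
  · simpa using key (fun a₁ a₂ b₁ b₂ b₃ => y a₁ a₂ (!b₁) (!b₂) (!b₃))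
      (fun a₁ a₂ h b₁ b₂ b₃ => by simpa using B1 a₁ a₂ h (!b₁) (!b₂) (!b₃))
      (fun b₁ b₂ b₃ => by simpa using Bt (!b₁) (!b₂) (!b₃))
      (fun b₁ b₂ b₃ => by simpa using Bh (!b₁) (!b₂) (!b₃))
      (fun c c₁ c₂ => by simpa using K (!c) (!c₁) (!c₂))
      (fun c c₁ c₂ => by simpa using L (!c) (!c₁) (!c₂)) (!b₂) (!b₃)
  · exact key y B1 Bt Bh K L b₂ b₃

/-! ## Assembly: all layers `m ≥ 2`, the shape lemma, and the registered stub -/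

/-- **The binary depth-three block reduces, all layers `m ≥ 2`**: every `4`-initial word
`4^{a₁} c₁ 4^{a₂} c₂ 4^{m-a₁-a₂} c₃` (`a₁ ≥ 1`, `cⱼ ∈ {1, 3}`) vanishes modulo `T3 m`, by
`depthThree_core` (`m ≥ 3`) and `depthThree_core_two` (`m = 2`, using block F1 below length
five for the two lift families). [folklore] -/
theorem depthThree_binary (hlow : ∀ W : List (Fin 5), W.length < 5 → IsConvergent W →
      W.count 0 = 0 → 0 < W.count 4 → sym W ∈ rel ⊔ e0Lower W)
    {m : ℕ} (hm : 2 ≤ m) {a₁ a₂ : ℕ} (ha : a₁ + a₂ ≤ m) (h1 : 1 ≤ a₁) (b₁ b₂ b₃ : Bool) :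
    y3 m a₁ a₂ b₁ b₂ b₃ = 0 := by
  rcases Nat.lt_or_ge m 3 with hm3 | hm3
  · obtain rfl : m = 2 := by omega
    obtain ⟨h10, h11, h20⟩ := depthThree_core_two (y3 2) (y3_familyB 2 1 le_rfl)
      (y3_familyB 2 2 (by norm_num) 0 0 (by norm_num))
      (y3_familyB2 2 1 1 le_rfl le_rfl 0 0 (by norm_num)) (y3_liftK hlow) (y3_liftL hlow) b₁ b₂ b₃
    rcases a₁ with _ | _ | _ | a₁
    · omega
    · rcases a₂ with _ | _ | a₂
      exacts [h10, h11, by omega]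
    · rcases a₂ with _ | a₂
      exacts [h20, by omega]
    · omega
  · exact depthThree_core m hm3 (y3 m) (y3_familyM33 m) (y3_familyB m)
      (fun t ht => y3_familyB2 m 1 t le_rfl ht) a₁ a₂ ha b₁ b₂ b₃

/-- Peeling the first block of `4`s: a word with a letter `≠ 4` is `4^a c W'` with `c ≠ 4`
(and the obvious letter counts). [folklore] -/
theorem exists_block : ∀ W : List (Fin 5), W.count 4 < W.length → ∃ (a : ℕ) (c : Fin 5)
    (W' : List (Fin 5)), c ≠ 4 ∧ W = List.replicate a 4 ++ c :: W' ∧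
      W'.count 4 + a = W.count 4 ∧ W'.length + a + 1 = W.length
  | [], h => by simp at h
  | x :: W, h => by
    by_cases hx : x = 4
    · subst hx
      simp only [List.count_cons_self, List.length_cons] at h
      obtain ⟨a, c, W', hc, hW, h4, hl⟩ := exists_block W (by omega)
      refine ⟨a + 1, c, W', hc, by rw [hW]; rfl, ?_, ?_⟩ <;> simp <;> omega
    · exact ⟨0, x, W, hx, rfl, by simp [hx], by simp⟩

/-- **Shape of the words of the block**: a convergent word with no letters `0`, `2` and exactly
three letters `≠ 4` is `X3 a₁ a₂ a₃ b₁ b₂ b₃`. [folklore] -/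
theorem exists_X3 (W : List (Fin 5)) (hW : IsConvergent W) (h0 : W.count 0 = 0) (h2 : W.count 2 = 0)
    (hd : W.count 4 + 3 = W.length) : ∃ a₁ a₂ a₃ b₁ b₂ b₃, W = X3 a₁ a₂ a₃ b₁ b₂ b₃ := by
  have hcol : ∀ c ∈ W, c ≠ 4 → ∃ b, c = col b := by
    intro c hc hc4
    have hc0 : c ≠ 0 := fun h => (List.count_pos_iff.2 (h ▸ hc)).ne' h0
    have hc2 : c ≠ 2 := fun h => (List.count_pos_iff.2 (h ▸ hc)).ne' h2
    have key : ∀ c : Fin 5, c ≠ 4 → c ≠ 0 → c ≠ 2 → c = col true ∨ c = col false := by decide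
    rcases key c hc4 hc0 hc2 with h | h
    exacts [⟨true, h⟩, ⟨false, h⟩]
  obtain ⟨a₁, c₁, W₁, hc₁, rfl, h4₁, hl₁⟩ := exists_block W (by omega)
  obtain ⟨a₂, c₂, W₂, hc₂, rfl, h4₂, hl₂⟩ := exists_block W₁ (by omega)
  obtain ⟨a₃, c₃, W₃, hc₃, rfl, h4₃, hl₃⟩ := exists_block W₂ (by omega)
  have hd₃ : W₃.count 4 = W₃.length := by omega
  have hW₃ : W₃ = [] := by
    by_contra hne
    have hlast : W₃.getLast hne = 4 :=
      ((List.count_eq_length.1 hd₃) _ (List.getLast_mem hne)).symm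
    apply hW.2
    rw [List.getLast?_append, List.getLast?_cons, List.getLast?_append, List.getLast?_cons,
      List.getLast?_append, List.getLast?_cons, List.getLast?_eq_some_getLast hne, hlast]
    rfl
  subst hW₃
  obtain ⟨b₁, rfl⟩ := hcol c₁ (by simp) hc₁
  obtain ⟨b₂, rfl⟩ := hcol c₂ (by simp) hc₂
  obtain ⟨b₃, rfl⟩ := hcol c₃ (by simp) hc₃
  exact ⟨a₁, a₂, a₃, b₁, b₂, b₃, rfl⟩

end Summit.KontsevichZagierPeriods.OctahedralSymmetry.OctaSpan.RegularE0

namespace Summit.KontsevichZagierPeriods.OctahedralSymmetry.OctaSpan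

open Literature.NumberTheory.Transcendental Literature.NumberTheory.Transcendental.LevelFour RegularE0

/-- **Block F1, the sub-layer "depth three over the poles `{0, i, -i}`", all weights** (registered
stub `stub_regular_e0_depthThree_binary` of the crux `OctahedralSpanAllWeights`, line `Sketch`):
a `4`-initial convergent word of length `n` with exactly three unit letters, all in `{1, 3}`
(poles `±i`; no pole `1`, no pole `-1`), reduces modulo `rel` to convergent `e₁`-free words of
length `n` with fewer letters `4` — given block F1 below length `n` (used only at `n = 5`, for the
two lift families of `depthThree_core_two`). Layer `m = n - 3 = 1` is the weight-four normal form;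
`m = 2` is `depthThree_core_two`; `m ≥ 3` is `depthThree_core` (families M33, B, B2 of finite
double shuffles with `Li`-indices at `-1`). [cite: Zhao2010, §2 (FDS)] -/
theorem stub_regular_e0_depthThree_binary (n : ℕ)
    (hlow : ∀ W : List (Fin 5), W.length < n → IsConvergent W → W.count 0 = 0 → 0 < W.count 4 →
      sym W ∈ rel ⊔ RegularE0.e0Lower W)
    (W : List (Fin 5)) (hn : W.length = n) (hhead : W.head? = some 4) (hW : IsConvergent W)
    (h0 : W.count 0 = 0) (h2 : W.count 2 = 0) (hdepth : W.count 4 + 3 = W.length) :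
    sym W ∈ rel ⊔ RegularE0.e0Lower W := by
  obtain ⟨a₁, a₂, a₃, b₁, b₂, b₃, rfl⟩ := exists_X3 W hW h0 h2 hdepth
  have ha₁ : 1 ≤ a₁ := by
    rcases a₁ with _ | a₁
    · cases b₁ <;> simp [X3, col] at hhead
    · omega
  rcases Nat.lt_or_ge (a₁ + a₂ + a₃) 2 with hm | hm
  · exact depthThree_one hW (by rw [X3_length]; omega) (by rw [X3_count_four]; omega)
  · have h := depthThree_binary (fun V hV => hlow V (by rw [← hn, X3_length]; omega)) hm (a₁ := a₁)
      (a₂ := a₂) (by omega) ha₁ b₁ b₂ b₃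
    rw [y3_eq rfl] at h
    have hT := (Submodule.Quotient.mk_eq_zero _).1 h
    rwa [T3, ← e0Lower_X3] at hT

end Summit.KontsevichZagierPeriods.OctahedralSymmetry.OctaSpan

end
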